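import Summits.AtomisticToContinuum.FouriersLaw.Theorems.BondHeatUncertaintyLinearResponseFTURBondHeatVarianceContinuityHelper7

/-!
# Aux 1 for stub `stub_timeIntegratedCurrentVarianceContinuity` of line `drude-controls-conductance` (R1) —
# crux `JunctionLocality.NonBallistic` (stmt-AtomisticToContinuum-9127):
# energy truncation of the kernel pairing of a GENERAL exponentially dominated observable

Support file (observable-agnostic re-run of Helper 7 of the landed K6b `LinearResponseFTUR.pairingCutoffApprox`,
which is written for a single bond current `j_i`). For the pinned chain (`ω₂ > 0`, `lam, β, γ ≥ 0`, `N ≥ 1`), ANY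
probability law `μ` invariant under the constructed kernels at temperatures `(a, b)` with an exponential moment
`∫ e^{ϑH} dμ ≤ M`, and ANY continuous observable `g` dominated as `|g| ≤ C e^{ϑH/4}` (`C ≥ 0`), the error made
in the kernel pairing `F(u) = ∫ g · (P_{u⁺} g) dμ` when `g` is replaced by its energy truncation
`g_K = χ_K(H) g`, `χ_K = max 0 (min 1 (K + 1 - H))` (continuous, compactly supported), is
`|∫ g·(P_u g) dμ - ∫ g_K·(P_u g_K) dμ| ≤ 2 √(C² e^{-ϑK/2} (M+1)) (1 + C²M)` (`pairingCutoffApproxObs`), by the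
rescaled `L²` bound `|∫ f·(P_u h) dμ| ≤ λ ∫f² + λ⁻¹ ∫h²` (the tree's AM–GM bound
`SubdiffusiveBondHeat.pinnedChain_abs_kernelPairing_le`) and the tail estimate `(g - g_K)² ≤ C² e^{-ϑK/2} e^{ϑH}`.
The proof is Helper 7's, verbatim up to `j_i ↦ g`. Used with `g = J_tot = Σ_i j_i` (the total current) in
the stub. Nothing here closes an item.
-/

noncomputable section

namespace Summit.AtomisticToContinuum.FouriersLaw.Theorems.NonBallistic

open MeasureTheory ProbabilityTheory Filter Topology Set
open scoped NNReal ENNReal Topology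
open Literature.MathematicalPhysics.KineticTheory.HeatConduction Literature.Probability.Process OscillatorChain
open Summit.AtomisticToContinuum.FouriersLaw.Theorems.SubdiffusiveBondHeat

section Pairing

variable {ω₂ lam β γ : ℝ} (hω : 0 < ω₂) (hl : 0 ≤ lam) (hβ : 0 ≤ β) (hγ : 0 ≤ γ) (N : ℕ) (a b : ℝ)
include hω hl hβ hγ

/-- **Rescaled `L²` bound on the kernel pairing**: for `f, h ∈ L²(μ)`, `μ` invariant, and every `λ > 0`,
`|∫ f · (P_{u⁺} h) dμ| ≤ λ ∫ f² dμ + λ⁻¹ ∫ h² dμ` (the tree's bound applied to `(√λ f, h/√λ)`; copy of the private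
lemma of K6b's Helper 7). [folklore] -/
private theorem abs_kernelPairing_le_scaled' (μ : Measure (PhaseSpace N)) [SFinite μ]
    (hinv : ∀ s : ℝ≥0, μ.bind ((pinnedChain ω₂ lam β γ).transitionKernel N a b s) = μ)
    {f h : PhaseSpace N → ℝ} (hf : Measurable f) (hh : Measurable h)
    (hf2 : Integrable (fun y => f y ^ 2) μ) (hh2 : Integrable (fun y => h y ^ 2) μ) (u : ℝ) {l : ℝ}
    (hl0 : 0 < l) :
    |∫ y, f y * (∫ y', h y' ∂((pinnedChain ω₂ lam β γ).transitionKernel N a b u.toNNReal y)) ∂μ| ≤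
      l * (∫ y, f y ^ 2 ∂μ) + l⁻¹ * ∫ y, h y ^ 2 ∂μ := by
  set s : ℝ := Real.sqrt l with hs
  have hs0 : 0 < s := Real.sqrt_pos.2 hl0
  have hs2 : s ^ 2 = l := Real.sq_sqrt hl0.le
  set f' : PhaseSpace N → ℝ := fun y => s * f y with hf'
  set h' : PhaseSpace N → ℝ := fun y => h y / s with hh'
  have hf'm : Measurable f' := hf.const_mul s
  have hh'm : Measurable h' := hh.div_const s
  have hf'2 : Integrable (fun y => f' y ^ 2) μ := by
    have : (fun y => f' y ^ 2) = fun y => s ^ 2 * f y ^ 2 := by funext y; simp only [hf']; ring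
    rw [this]; exact hf2.const_mul _
  have hh'2 : Integrable (fun y => h' y ^ 2) μ := by
    have : (fun y => h' y ^ 2) = fun y => (s ^ 2)⁻¹ * h y ^ 2 := by funext y; simp only [hh']; field_simp
    rw [this]; exact hh2.const_mul _
  have key := pinnedChain_abs_kernelPairing_le hω hl hβ hγ N a b μ hinv hf'm hh'm hf'2 hh'2 u
  have e1 : ∀ y, f' y * (∫ y', h' y' ∂((pinnedChain ω₂ lam β γ).transitionKernel N a b u.toNNReal y)) =
      f y * ∫ y', h y' ∂((pinnedChain ω₂ lam β γ).transitionKernel N a b u.toNNReal y) := by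
    intro y
    show s * f y * (∫ y', h y' / s ∂((pinnedChain ω₂ lam β γ).transitionKernel N a b u.toNNReal y)) = _
    rw [integral_div]
    field_simp
  have e2 : ∫ y, f' y ^ 2 ∂μ = l * ∫ y, f y ^ 2 ∂μ := by
    rw [← integral_const_mul]
    refine integral_congr_ae (Eventually.of_forall fun y => ?_)
    show (s * f y) ^ 2 = l * f y ^ 2
    rw [mul_pow, hs2]
  have e3 : ∫ y, h' y ^ 2 ∂μ = l⁻¹ * ∫ y, h y ^ 2 ∂μ := by
    rw [← integral_const_mul]
    refine integral_congr_ae (Eventually.of_forall fun y => ?_)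
    show (h y / s) ^ 2 = l⁻¹ * h y ^ 2
    rw [div_pow, hs2]; field_simp
  simp_rw [e1] at key
  rwa [e2, e3] at key

/-- **Energy truncation of the kernel pairing of a general dominated observable, uniformly in the temperatures**:
for the pinned chain (`ω₂ > 0`, `lam, β, γ ≥ 0`, `N ≥ 1`), a probability law `μ` invariant under the kernels at
temperatures `(a, b)` (`a, b > 0`) with `∫ e^{ϑH} dμ ≤ M` (`ϑ > 0`, `ϑ/4 < 1/max(a,b)`), a continuous observable
`g` dominated as `|g| ≤ C e^{ϑH/4}` (`C ≥ 0`), a real time `u` and a truncation level `K`, with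
`χ_K(x) = max 0 (min 1 (K + 1 - H x))`:
`|∫ g·(P_{u⁺} g) dμ - ∫ (χ_K g)·(P_{u⁺}(χ_K g)) dμ| ≤ 2 √(C² e^{-ϑK/2} (M+1)) (1 + C² M)`. [folklore] -/
private theorem pairing_cutoff_approx_obs (hN : 0 < N) (μ : Measure (PhaseSpace N)) [IsProbabilityMeasure μ]
    (hinv : ∀ s : ℝ≥0, μ.bind ((pinnedChain ω₂ lam β γ).transitionKernel N a b s) = μ)
    (ha : 0 < a) (hb : 0 < b) {ϑ M C : ℝ} (hϑ : 0 < ϑ) (hϑab : ϑ / 4 < 1 / max a b)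
    (hVint : Integrable (fun x => Real.exp (ϑ * (pinnedChain ω₂ lam β γ).hamiltonian N x)) μ)
    (hVM : ∫ x, Real.exp (ϑ * (pinnedChain ω₂ lam β γ).hamiltonian N x) ∂μ ≤ M)
    {g : PhaseSpace N → ℝ} (hgc : Continuous g) (hC0 : 0 ≤ C)
    (hC : ∀ x, |g x| ≤ C * Real.exp (ϑ / 4 * (pinnedChain ω₂ lam β γ).hamiltonian N x)) (u K : ℝ) :
    |(∫ y, g y * (∫ y', g y' ∂((pinnedChain ω₂ lam β γ).transitionKernel N a b u.toNNReal y)) ∂μ) -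
      ∫ y, (max 0 (min 1 (K + 1 - (pinnedChain ω₂ lam β γ).hamiltonian N y)) * g y) *
        (∫ y', (max 0 (min 1 (K + 1 - (pinnedChain ω₂ lam β γ).hamiltonian N y')) * g y')
          ∂((pinnedChain ω₂ lam β γ).transitionKernel N a b u.toNNReal y)) ∂μ| ≤
      2 * Real.sqrt (C ^ 2 * Real.exp (-(ϑ / 2 * K)) * (M + 1)) * (1 + C ^ 2 * M) := by
  set P := pinnedChain ω₂ lam β γ with hP
  set H := P.hamiltonian N with hH
  have hHc : Continuous H := pinnedChain_continuous_hamiltonian ω₂ lam β γ N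
  have hH0 : ∀ x, 0 ≤ H x := fun x => pinnedChain_hamiltonian_nonneg hω.le hl hβ γ N x
  set V : PhaseSpace N → ℝ := fun x => Real.exp (ϑ * H x) with hV
  have hgm : Measurable g := hgc.measurable
  set χ : PhaseSpace N → ℝ := fun x => max 0 (min 1 (K + 1 - H x)) with hχ
  have hχc : Continuous χ := continuous_const.max (continuous_const.min (continuous_const.sub hHc))
  have hχ0 : ∀ x, 0 ≤ χ x := fun x => le_max_left _ _
  have hχ1 : ∀ x, χ x ≤ 1 := fun x => max_le zero_le_one (min_le_left _ _)
  have hχ_one : ∀ x, H x ≤ K → χ x = 1 := fun x hx => by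
    show max 0 (min 1 (K + 1 - H x)) = 1
    rw [min_eq_left (by linarith only [hx]), max_eq_right zero_le_one]
  set gK : PhaseSpace N → ℝ := fun x => χ x * g x with hgK
  have hgKm : Measurable gK := (hχc.mul hgc).measurable
  have hMnn : 0 ≤ M := le_trans (integral_nonneg fun x => (Real.exp_pos _).le) hVM
  set κ := P.transitionKernel N a b u.toNNReal with hκ
  haveI : IsMarkovKernel κ := pinnedChain_isMarkovKernel_transitionKernel hω hl hβ hγ N a b _
  -- pointwise bounds
  have hg2 : ∀ x, g x ^ 2 ≤ C ^ 2 * V x := fun x => by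
    have h1 : g x ^ 2 ≤ (C * Real.exp (ϑ / 4 * H x)) ^ 2 := by
      rw [← sq_abs]; exact pow_le_pow_left₀ (abs_nonneg _) (hC x) 2
    refine h1.trans ?_
    rw [mul_pow, ← Real.exp_nat_mul]
    refine mul_le_mul_of_nonneg_left (Real.exp_le_exp.2 ?_) (sq_nonneg _)
    push_cast
    nlinarith only [hH0 x, hϑ]
  have hgK2 : ∀ x, gK x ^ 2 ≤ g x ^ 2 := fun x => by
    show (χ x * g x) ^ 2 ≤ _
    rw [mul_pow]
    calc χ x ^ 2 * g x ^ 2 ≤ 1 * g x ^ 2 :=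
          mul_le_mul_of_nonneg_right (pow_le_one₀ (hχ0 x) (hχ1 x)) (sq_nonneg _)
      _ = g x ^ 2 := one_mul _
  have htail : ∀ x, (g x - gK x) ^ 2 ≤ C ^ 2 * Real.exp (-(ϑ / 2 * K)) * V x := fun x => by
    by_cases hx : H x ≤ K
    · show (g x - χ x * g x) ^ 2 ≤ _
      rw [hχ_one x hx, one_mul, sub_self, zero_pow two_ne_zero]; positivity
    · have hxK : K < H x := not_le.1 hx
      have h1 : (g x - gK x) ^ 2 ≤ g x ^ 2 := by
        show (g x - χ x * g x) ^ 2 ≤ _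
        rw [show g x - χ x * g x = (1 - χ x) * g x by ring, mul_pow]
        calc (1 - χ x) ^ 2 * g x ^ 2 ≤ 1 * g x ^ 2 :=
              mul_le_mul_of_nonneg_right (pow_le_one₀ (by linarith only [hχ1 x]) (by linarith only [hχ0 x]))
                (sq_nonneg _)
          _ = g x ^ 2 := one_mul _
      have h2 : g x ^ 2 ≤ C ^ 2 * Real.exp (ϑ / 2 * H x) := by
        have h1 : g x ^ 2 ≤ (C * Real.exp (ϑ / 4 * H x)) ^ 2 := by
          rw [← sq_abs]; exact pow_le_pow_left₀ (abs_nonneg _) (hC x) 2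
        refine h1.trans (le_of_eq ?_)
        rw [mul_pow, ← Real.exp_nat_mul]; congr 1; push_cast; ring_nf
      refine h1.trans (h2.trans ?_)
      rw [mul_assoc, ← Real.exp_add]
      refine mul_le_mul_of_nonneg_left (Real.exp_le_exp.2 ?_) (sq_nonneg _)
      nlinarith only [hxK, hϑ]
  -- integrability and the three `L²` norms
  have hg2i : Integrable (fun y => g y ^ 2) μ :=
    (hVint.const_mul (C ^ 2)).mono' (hgc.pow 2).aestronglyMeasurable (Eventually.of_forall fun x => by
      rw [Real.norm_eq_abs, abs_of_nonneg (sq_nonneg _)]; exact hg2 x)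
  have hgK2i : Integrable (fun y => gK y ^ 2) μ :=
    hg2i.mono' ((hχc.mul hgc).pow 2).aestronglyMeasurable (Eventually.of_forall fun x => by
      rw [Real.norm_eq_abs, abs_of_nonneg (sq_nonneg _)]; exact hgK2 x)
  have hd2i : Integrable (fun y => (g y - gK y) ^ 2) μ :=
    (hVint.const_mul (C ^ 2 * Real.exp (-(ϑ / 2 * K)))).mono' ((hgc.sub (hχc.mul hgc)).pow 2).aestronglyMeasurable
      (Eventually.of_forall fun x => by rw [Real.norm_eq_abs, abs_of_nonneg (sq_nonneg _)]; exact htail x)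
  have hA : ∫ y, g y ^ 2 ∂μ ≤ C ^ 2 * M := by
    calc ∫ y, g y ^ 2 ∂μ ≤ ∫ y, C ^ 2 * V y ∂μ := integral_mono hg2i (hVint.const_mul _) hg2
      _ = C ^ 2 * ∫ y, V y ∂μ := integral_const_mul _ _
      _ ≤ C ^ 2 * M := mul_le_mul_of_nonneg_left hVM (sq_nonneg _)
  have hAK : ∫ y, gK y ^ 2 ∂μ ≤ C ^ 2 * M := (integral_mono hgK2i hg2i hgK2).trans hA
  set τ : ℝ := C ^ 2 * Real.exp (-(ϑ / 2 * K)) * (M + 1) with hτ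
  have hτ0 : 0 < τ ∨ C = 0 := by
    rcases eq_or_lt_of_le hC0 with h | h
    · exact Or.inr h.symm
    · exact Or.inl (by positivity)
  have hD : ∫ y, (g y - gK y) ^ 2 ∂μ ≤ τ := by
    calc ∫ y, (g y - gK y) ^ 2 ∂μ ≤ ∫ y, C ^ 2 * Real.exp (-(ϑ / 2 * K)) * V y ∂μ :=
          integral_mono hd2i (hVint.const_mul _) htail
      _ = C ^ 2 * Real.exp (-(ϑ / 2 * K)) * ∫ y, V y ∂μ := integral_const_mul _ _
      _ ≤ C ^ 2 * Real.exp (-(ϑ / 2 * K)) * M := mul_le_mul_of_nonneg_left hVM (by positivity)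
      _ ≤ τ := by rw [hτ]; nlinarith only [sq_nonneg C, Real.exp_pos (-(ϑ / 2 * K)), hMnn]
  -- integrability of the observables against each `P_u(y, ·)` ((3.4) at the exponent `ϑ/4`)
  have hgκ : ∀ y, Integrable g (κ y) := by
    intro y
    have h34 := lintegral_exp_mul_hamiltonian_pinnedChainSemigroup_le hω hl hβ hγ hN ha.le hb.le ha hb
      (θ := ϑ / 4) (by positivity) hϑab u.toNNReal y
    have hexp : Integrable (fun x => Real.exp (ϑ / 4 * H x)) (κ y) := by
      refine ⟨(Real.continuous_exp.comp (continuous_const.mul hHc)).aestronglyMeasurable, ?_⟩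
      show ∫⁻ x, ‖Real.exp (ϑ / 4 * H x)‖ₑ ∂(κ y) < (⊤ : ℝ≥0∞)
      have : ∫⁻ x, ‖Real.exp (ϑ / 4 * H x)‖ₑ ∂(κ y) = ∫⁻ x, ENNReal.ofReal (Real.exp (ϑ / 4 * H x)) ∂(κ y) :=
        lintegral_congr fun x => Real.enorm_eq_ofReal (Real.exp_pos _).le
      rw [this]
      exact lt_of_le_of_lt h34 ENNReal.ofReal_lt_top
    exact (hexp.const_mul C).mono' hgc.aestronglyMeasurable (Eventually.of_forall fun x => by
      rw [Real.norm_eq_abs]; exact hC x)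
  have hgKκ : ∀ y, Integrable gK (κ y) := fun y =>
    (hgκ y).norm.mono' (hχc.mul hgc).aestronglyMeasurable (Eventually.of_forall fun x => by
      show ‖χ x * g x‖ ≤ ‖g x‖
      rw [norm_mul, Real.norm_eq_abs, abs_of_nonneg (hχ0 x)]
      calc χ x * ‖g x‖ ≤ 1 * ‖g x‖ := mul_le_mul_of_nonneg_right (hχ1 x) (norm_nonneg _)
        _ = ‖g x‖ := one_mul _)
  -- split `∫ g·Pg - ∫ gK·PgK = ∫ (g - gK)·Pg + ∫ gK·P(g - gK)`
  have hI1 := (pinnedChain_integrable_mul_act_of_invariant hω hl hβ hγ N a b μ u.toNNReal (hinv _) hgm hgm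
    hg2i hg2i).1
  have hI2 := (pinnedChain_integrable_mul_act_of_invariant hω hl hβ hγ N a b μ u.toNNReal (hinv _) hgKm hgKm
    hgK2i hgK2i).1
  have hdm : Measurable (fun y => g y - gK y) := hgm.sub hgKm
  have hI3 := (pinnedChain_integrable_mul_act_of_invariant hω hl hβ hγ N a b μ u.toNNReal (hinv _)
    (f := fun y => g y - gK y) (h := g) hdm hgm hd2i hg2i).1
  have hI4 := (pinnedChain_integrable_mul_act_of_invariant hω hl hβ hγ N a b μ u.toNNReal (hinv _)
    (f := gK) (h := fun y => g y - gK y) hgKm hdm hgK2i hd2i).1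
  have hsplit : (∫ y, g y * (∫ y', g y' ∂κ y) ∂μ) - ∫ y, gK y * (∫ y', gK y' ∂κ y) ∂μ =
      (∫ y, (g y - gK y) * (∫ y', g y' ∂κ y) ∂μ) + ∫ y, gK y * (∫ y', (g y' - gK y') ∂κ y) ∂μ := by
    rw [← integral_sub hI1 hI2, ← integral_add hI3 hI4]
    refine integral_congr_ae (Eventually.of_forall fun y => ?_)
    simp only
    rw [integral_sub (hgκ y) (hgKκ y)]
    ring
  -- the two rescaled `L²` bounds
  have hfinal : |(∫ y, g y * (∫ y', g y' ∂κ y) ∂μ) - ∫ y, gK y * (∫ y', gK y' ∂κ y) ∂μ| ≤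
      2 * Real.sqrt τ * (1 + C ^ 2 * M) := by
    rcases hτ0 with hτ0 | hC00
    · set s : ℝ := Real.sqrt τ with hs
      have hs0 : 0 < s := Real.sqrt_pos.2 hτ0
      have hs2 : s * s = τ := Real.mul_self_sqrt hτ0.le
      have hb1 := abs_kernelPairing_le_scaled' hω hl hβ hγ N a b μ hinv (hgm.sub hgKm) hgm hd2i hg2i u
        (l := s⁻¹) (inv_pos.2 hs0)
      have hb2 := abs_kernelPairing_le_scaled' hω hl hβ hγ N a b μ hinv hgKm (hgm.sub hgKm) hgK2i hd2i u hs0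
      rw [inv_inv] at hb1
      rw [hsplit]
      refine (abs_add_le _ _).trans ?_
      have h1 : s⁻¹ * ∫ y, (g y - gK y) ^ 2 ∂μ ≤ s := by
        rw [inv_mul_le_iff₀ hs0, hs2]; exact hD
      have h2 : s * ∫ y, g y ^ 2 ∂μ ≤ s * (C ^ 2 * M) := mul_le_mul_of_nonneg_left hA hs0.le
      have h3 : s * ∫ y, gK y ^ 2 ∂μ ≤ s * (C ^ 2 * M) := mul_le_mul_of_nonneg_left hAK hs0.le
      calc |∫ y, (g y - gK y) * (∫ y', g y' ∂κ y) ∂μ| + |∫ y, gK y * (∫ y', (g y' - gK y') ∂κ y) ∂μ|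
          ≤ (s⁻¹ * ∫ y, (g y - gK y) ^ 2 ∂μ + s * ∫ y, g y ^ 2 ∂μ) +
            (s * ∫ y, gK y ^ 2 ∂μ + s⁻¹ * ∫ y, (g y - gK y) ^ 2 ∂μ) := add_le_add hb1 hb2
        _ ≤ (s + s * (C ^ 2 * M)) + (s * (C ^ 2 * M) + s) := by linarith only [h1, h2, h3]
        _ = 2 * s * (1 + C ^ 2 * M) := by ring
    · -- `C = 0`: the observable vanishes identically
      have hg0 : ∀ x, g x = 0 := fun x => by
        have := hC x; rw [hC00, zero_mul] at this; exact abs_nonpos_iff.1 this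
      have hgK0 : ∀ x, gK x = 0 := fun x => by show χ x * g x = 0; rw [hg0 x, mul_zero]
      simp only [hg0, hgK0, zero_mul, integral_zero, sub_self, abs_zero]
      positivity
  exact hfinal

end Pairing

/-- **Energy truncation of the kernel pairing of a general dominated observable** (registered sub-goal of
`stub_timeIntegratedCurrentVarianceContinuity`; closed form of `pairing_cutoff_approx_obs`, the observable-agnostic
twin of K6b's `LinearResponseFTUR.pairingCutoffApprox`): for the pinned chain (`ω₂ > 0`, `lam, β, γ ≥ 0`, `N ≥ 1`),
a probability law `μ` invariant under the kernels at temperatures `a, b > 0` with `∫ e^{ϑH} dμ ≤ M`, `0 < ϑ`,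
`ϑ/4 < 1/max(a,b)`, a continuous observable `g` dominated as `|g| ≤ C e^{ϑH/4}` (`C ≥ 0`), a real time `u` and
a level `K`: `|∫ g·(P_{u⁺} g) dμ - ∫ (χ_K g)·(P_{u⁺}(χ_K g)) dμ| ≤ 2 √(C² e^{-ϑK/2} (M+1)) (1 + C² M)`,
`χ_K = max 0 (min 1 (K + 1 - H))`. [folklore] -/
theorem pairingCutoffApproxObs :
    ∀ (ω₂ lam β γ : ℝ), 0 < ω₂ → 0 ≤ lam → 0 ≤ β → 0 ≤ γ → ∀ (N : ℕ), 0 < N → ∀ (a b : ℝ)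
      (μ : Measure (PhaseSpace N)), IsProbabilityMeasure μ →
      (∀ s : ℝ≥0, μ.bind ((pinnedChain ω₂ lam β γ).transitionKernel N a b s) = μ) →
      0 < a → 0 < b → ∀ (ϑ M C : ℝ), 0 < ϑ → ϑ / 4 < 1 / max a b →
      Integrable (fun x => Real.exp (ϑ * (pinnedChain ω₂ lam β γ).hamiltonian N x)) μ →
      ∫ x, Real.exp (ϑ * (pinnedChain ω₂ lam β γ).hamiltonian N x) ∂μ ≤ M →
      ∀ (g : PhaseSpace N → ℝ), Continuous g → 0 ≤ C →
      (∀ x, |g x| ≤ C * Real.exp (ϑ / 4 * (pinnedChain ω₂ lam β γ).hamiltonian N x)) →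
      ∀ (u K : ℝ),
      |(∫ y, g y * (∫ y', g y' ∂((pinnedChain ω₂ lam β γ).transitionKernel N a b u.toNNReal y)) ∂μ) -
        ∫ y, (max 0 (min 1 (K + 1 - (pinnedChain ω₂ lam β γ).hamiltonian N y)) * g y) *
          (∫ y', (max 0 (min 1 (K + 1 - (pinnedChain ω₂ lam β γ).hamiltonian N y')) * g y')
            ∂((pinnedChain ω₂ lam β γ).transitionKernel N a b u.toNNReal y)) ∂μ| ≤
        2 * Real.sqrt (C ^ 2 * Real.exp (-(ϑ / 2 * K)) * (M + 1)) * (1 + C ^ 2 * M) := by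
  intro ω₂ lam β γ hω hl hβ hγ N hN a b μ hμ hinv ha hb ϑ M C hϑ hϑab hVint hVM g hgc hC0 hC u K
  exact pairing_cutoff_approx_obs hω hl hβ hγ N a b hN μ hinv ha hb hϑ hϑab hVint hVM hgc hC0 hC u K

end Summit.AtomisticToContinuum.FouriersLaw.Theorems.NonBallistic

end
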